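import Summits.QuantumFields.BalabanUV.Beta.BorderedHessianResidual
import Summits.QuantumFields.BalabanUV.Beta.GaugeMultiplierBlockMean
import Summits.QuantumFields.BalabanUV.Beta.AxialCoordinateProjectorCoarseRules

/-!
# The residual against the block-mean dressing: `resid N ∘ piKBm = piKBmC` — the gauge term `dδd ∘ GamM` of the covariance columns is
# invisible to `Π̂_bmᵀ` (β sub-cell, row BETA-an2, gen 13; step (U3) of the relative-inverse rules 3–4 at `j = 0`)

HONEST FRAMING (cell charter, verbatim): «discharging BetaPertH makes Balaban's UV stability UNCONDITIONAL — a real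
constructive-QFT result; it is NOT the continuum limit and NOT the Clay problem.»  DERIVED cell leaf (pub-balaban β sub-cell, lane
an2 gen 13); no statement of Bałaban's papers is typed here, no `[cite:]` tag, no `Prop` fact; it instantiates no binder of the
β-function wall by itself.  NOT `BetaPertH`; NOT continuum; NOT Clay.

## What is here
`resid N = bhK N ∘ KInv N = [[δ + dδd∘GamM, 0], [0, δ_coarse]]` (`BorderedHessianResidual`).  Composed with `piKBm (toSite r) N` (the matrix
of `Π̂_bmᵀ`), the Kronecker part returns `piKBm` with its multiplier identity cut down to the coarse sites — `piKBmC` of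
`AxialCoordinateProjectorCoarseRules` — and the gauge part is, entry by entry, `dδd` of the gauge multiplier of the covariance field driven
by a ROW of `Π_bm`, which vanishes (`GaugeMultiplierBlockMean.McolSum_rowBm_eq_zero`: the row's codifferential is block-constant):
* §1 the window sum of the Kronecker part (`sum_cube_ite_pmBm`), the gauge part as `dδd (McolSum …)` (`opM` linearity), the support set
  `rowSupp w` and `δSum_rowSupp : δSum (rowSupp w) (pmBm-weights) = rowBm` (window redundancy `window_of_pmBm_ne_zero`);
* §2 **`comp_resid_piKBm : comp (resid N) (piKBm (toSite r) N) = piKBmC (toSite r) N`** and its transpose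
  **`comp_trK_piKBm_trK_resid : comp (trK (piKBm (toSite r) N)) (trK (resid N)) = trK (piKBmC (toSite r) N)`**.

All declarations `[folklore]`; axioms standard.  Provenance: b2b-balaban β sub-cell, unit beta-an2 gen 13, 2026-08-20 (v1); over
`BorderedHessianResidual`, `GaugeMultiplierBlockMean`, `AxialCoordinateProjectorCoarseRules`, `AxialDressingRootedBm(Kernel)` BY NAME.
-/

open Finset
open scoped BigOperators
open Literature.Probability.LatticeModels (TorusSite Torus.proj Torus.proj_apply)
open Literature.MathematicalPhysics.QuantumFieldTheory
open Literature.MathematicalPhysics.QuantumFieldTheory.Balaban1983to89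
open Literature.MathematicalPhysics.QuantumFieldTheory.Balaban1983to89.Beta
open B12Sec2to5 (l1 l1_nonneg)
open ExpKernelCalculus (MKer Decays BiLoc comp tr shiftK)
open AffineAveraging (Form0 Form1 Form2 box toSite unitVec unitVec_apply dz curv curvAdj codiff₁ blockSum contourSum)
open AffineReproduction (contourSumAdj IsBlockConst)
open KKTFluctuationEnergy (Mcol δcol)
open KernelSpecInstance (opM)
open ResolventComposition (δSum McolSum)
open OneStepResolventKernel (Fib KInv)
open Summit.QuantumFields.BalabanUV.Beta.TameKernelCalculus
open Summit.QuantumFields.BalabanUV.Beta.AxialDressingRooted (cube mem_cube zero_mem_cube pmBm piKBm piKBm_inl_inl piKBm_inl_inr piKBm_inr_inl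
  piKBm_inr_inr window_of_pmBm_ne_zero comp_piKBm_inr tsum_window' piKBmC piKBmC_inl_inl piKBmC_inl_inr piKBmC_inr_inl piKBmC_inr_inr)

namespace Summit.QuantumFields.BalabanUV.Beta.BorderedHessian

noncomputable section

variable {d : ℕ} (N : ℕ)

/-! ## §1 The two parts of the field–field window sum -/

section Parts

/-- [folklore] THE KRONECKER PART of the window sum returns the (windowed) matrix entry of `Π_bmᵀ`. -/
theorem sum_cube_ite_pmBm (ρ : Fin (d + 1) → ℤ) (x w : Fin (d + 1) → ℤ) (κ β : Fin (d + 1)) :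
    ∑ v ∈ cube (d + 1) N, ∑ l : Fin (d + 1), (if κ = l ∧ x = w - v then (1 : ℝ) else 0) * pmBm ρ N β w l (w - v) =
      piKBm ρ N x w (Sum.inl κ) (Sum.inl β) := by
  have e : ∀ v, ∑ l : Fin (d + 1), (if κ = l ∧ x = w - v then (1 : ℝ) else 0) * pmBm ρ N β w l (w - v) =
      if v = w - x then pmBm ρ N β w κ x else 0 := by
    intro v
    rw [Finset.sum_eq_single κ (fun l _ hl => by rw [if_neg (fun h => hl h.1.symm), zero_mul])
      (fun h => absurd (Finset.mem_univ κ) h)]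
    by_cases hv : v = w - x
    · subst hv
      rw [if_pos ⟨rfl, by abel⟩, one_mul, if_pos rfl, sub_sub_cancel]
    · rw [if_neg (fun h => hv (by rw [h.2]; abel)), zero_mul, if_neg hv]
  rw [Finset.sum_congr rfl (fun v _ => e v), Finset.sum_ite_eq', piKBm_inl_inl]

/-- [folklore] `opM f = dz (codiff₁ (dz f))`. -/
theorem opM_apply (f : Form0 (d + 1) ℝ) : opM f = dz (codiff₁ (dz f)) := rfl

/-- [folklore] The SUPPORT SET of the rows of `Π_bm` at the column site `w`: all bonds `(l, w − v)`, `v` in the window. -/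
def rowSupp (w : Fin (d + 1) → ℤ) : Finset (Fin (d + 1) × (Fin (d + 1) → ℤ)) :=
  (Finset.univ : Finset (Fin (d + 1))) ×ˢ ((cube (d + 1) N).image fun v => w - v)

/-- [folklore] Membership in `rowSupp`. -/
theorem mem_rowSupp {w : Fin (d + 1) → ℤ} {b : Fin (d + 1) × (Fin (d + 1) → ℤ)} : b ∈ rowSupp N w ↔ w - b.2 ∈ cube (d + 1) N := by
  unfold rowSupp
  rw [Finset.mem_product]
  simp only [Finset.mem_univ, true_and, Finset.mem_image]
  constructor
  · rintro ⟨v, hv, hvb⟩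
    rw [← hvb, sub_sub_cancel]
    exact hv
  · intro h
    exact ⟨w - b.2, h, by abel⟩

/-- [folklore] A double window sum as a sum over `rowSupp`. -/
theorem sum_rowSupp_eq {w : Fin (d + 1) → ℤ} (F : Fin (d + 1) → (Fin (d + 1) → ℤ) → ℝ) :
    ∑ b ∈ rowSupp N w, F b.1 b.2 = ∑ v ∈ cube (d + 1) N, ∑ l : Fin (d + 1), F l (w - v) := by
  unfold rowSupp
  rw [Finset.sum_product]
  refine (Finset.sum_congr rfl fun l _ => Finset.sum_image ?_).trans Finset.sum_comm
  intro v _ v' _ h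
  exact sub_right_injective h

/-- [folklore] THE GAUGE PART of the window sum is `dδd` of the gauge multiplier of the covariance field driven by the row `(β, w)` of
`Π_bm` (linearity of `opM`). -/
theorem sum_cube_opM_Mcol [NeZero N] (ρ : Fin (d + 1) → ℤ) (x w : Fin (d + 1) → ℤ) (κ β : Fin (d + 1)) :
    ∑ v ∈ cube (d + 1) N, ∑ l : Fin (d + 1), dz (codiff₁ (dz (Mcol (N := N) l (w - v)))) κ x * pmBm ρ N β w l (w - v) =
      dz (codiff₁ (dz (McolSum (N := N) (rowSupp N w) (fun b => pmBm ρ N β w b.1 b.2)))) κ x := by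
  have hsum : McolSum (N := N) (rowSupp N w) (fun b => pmBm ρ N β w b.1 b.2)
      = ∑ b ∈ rowSupp N w, pmBm ρ N β w b.1 b.2 • Mcol (N := N) b.1 b.2 := by
    funext z
    rw [Finset.sum_apply]
    simp only [McolSum, Pi.smul_apply, smul_eq_mul]
  rw [hsum, ← opM_apply, map_sum, Finset.sum_apply, Finset.sum_apply,
    sum_rowSupp_eq N (fun l z => (opM (pmBm ρ N β w l z • Mcol (N := N) l z)) κ x)]
  refine Finset.sum_congr rfl fun v _ => Finset.sum_congr rfl fun l _ => ?_
  rw [map_smul, Pi.smul_apply, Pi.smul_apply, smul_eq_mul, opM_apply, mul_comm]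

/-- [folklore] THE FORCE OF THE `rowSupp`-COMBINATION IS THE ROW of `Π_bm` (in-block root: the window carries the row). -/
theorem δSum_rowSupp (hN : 1 ≤ N) {r : Fin (d + 1) → ℕ} (hr : r ∈ box (d + 1) N) (β : Fin (d + 1)) (w : Fin (d + 1) → ℤ) :
    δSum (rowSupp N w) (fun b => pmBm (toSite r) N β w b.1 b.2) = rowBm (toSite r) N β w := by
  classical
  funext μ y
  rw [rowBm_apply]
  unfold ResolventComposition.δSum
  have e : ∀ b ∈ rowSupp N w, pmBm (toSite r) N β w b.1 b.2 * δcol b.1 b.2 μ y = if b = (μ, y) then pmBm (toSite r) N β w μ y else 0 := by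
    intro b _
    unfold KKTFluctuationEnergy.δcol
    by_cases hb : b = (μ, y)
    · subst hb; simp
    · rw [if_neg hb, if_neg, mul_zero]
      rintro ⟨h1, h2⟩
      exact hb (Prod.ext h1.symm h2.symm)
  rw [Finset.sum_congr rfl e, Finset.sum_ite_eq']
  split_ifs with hmem
  · rfl
  · by_contra hne
    exact hmem ((mem_rowSupp N).2 (window_of_pmBm_ne_zero hN hr (Ne.symm hne)))

end Parts

/-! ## §2 `resid N ∘ piKBm = piKBmC` and its transpose -/

section Main

/-- [folklore] **THE RESIDUAL IS INVISIBLE TO THE BLOCK-MEAN DRESSING UP TO THE COARSE RESTRICTION**: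
`comp (resid N) (piKBm (toSite r) N) = piKBmC (toSite r) N` (in-block root). -/
theorem comp_resid_piKBm [NeZero N] {r : Fin (d + 1) → ℕ} (hr : r ∈ box (d + 1) N) :
    comp (resid N) (piKBm (toSite r) N) = piKBmC (d := d) (toSite r) N := by
  have hN : 1 ≤ N := Nat.one_le_iff_ne_zero.mpr (NeZero.ne N)
  funext x w a b
  rcases b with β | β
  · rcases a with κ | κ
    · -- field–field: window sum = gauge part + Kronecker part
      unfold ExpKernelCalculus.comp
      have e : ∀ z, ∑ f : Fib d, resid N x z (Sum.inl κ) f * piKBm (toSite r) N z w f (Sum.inl β) =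
          if w - z ∈ cube (d + 1) N then ∑ l : Fin (d + 1), resid N x z (Sum.inl κ) (Sum.inl l) * pmBm (toSite r) N β w l z else 0 := by
        intro z
        rw [Fintype.sum_sum_type]
        simp only [resid_inl_inr, zero_mul, Finset.sum_const_zero, add_zero, piKBm_inl_inl]
        split_ifs
        · rfl
        · simp
      simp_rw [e]
      rw [tsum_window']
      simp only [resid_inl_inl, add_mul, Finset.sum_add_distrib]
      rw [sum_cube_opM_Mcol, sum_cube_ite_pmBm, McolSum_rowBm_eq_zero (toSite r) β w (rowSupp N w) (δSum_rowSupp N hN hr β w),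
        piKBmC_inl_inl]
      simp [dz, codiff₁]
    · -- multiplier–field: every term vanishes
      unfold ExpKernelCalculus.comp
      rw [piKBmC_inr_inl]
      refine (tsum_congr fun z => ?_).trans tsum_zero
      rw [Fintype.sum_sum_type]
      simp [resid_inr_inl, piKBm_inr_inl]
  · rw [comp_piKBm_inr]
    rcases a with κ | κ
    · rw [resid_inl_inr, piKBmC_inl_inr]
    · rw [resid_inr_inr, piKBmC_inr_inr]

/-- [folklore] **TRANSPOSED FORM**: `comp (trK (piKBm (toSite r) N)) (trK (resid N)) = trK (piKBmC (toSite r) N)`. -/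
theorem comp_trK_piKBm_trK_resid [NeZero N] {r : Fin (d + 1) → ℕ} (hr : r ∈ box (d + 1) N) :
    comp (trK (piKBm (toSite r) N)) (trK (resid N)) = trK (piKBmC (d := d) (toSite r) N) := by
  rw [← trK_comp, comp_resid_piKBm N hr]

end Main

end

end Summit.QuantumFields.BalabanUV.Beta.BorderedHessian
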